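import Literature.MathematicalPhysics.StatisticalMechanics.TriangularLatticeMaximalDeviation
import Literature.Geometry.DiscreteGeometry.HarborthContactNumberProof
import HarnessLib

/-!
# Schmidt 2013, Theorem 2.6 PROVED: the flat-norm rate `N^{−1/4}` for sticky-disc ground states is
# optimal — two ground states at flat distance `≥ c N^{−1/4}` for infinitely many `N`

Topic `Literature/MathematicalPhysics/StatisticalMechanics`; sequel to `StickyDiscFluctuations.lean`
(Schmidt 2013 typed: the flat norm `flatNorm`, Theorem 2.4 / Theorem 2.6 / Proposition 2.7 as the named
facts `Schmidt2013_deviationUpperBound` / `Schmidt2013_deviationLowerBound` / `Schmidt2013_uniqueGroundState`;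
Proposition 2.7 proved there, Theorem 2.4 proved in `TriangularLatticeWulffShape.lean`).  This file
DISCHARGES the last of the three, `Schmidt2013_deviationLowerBound_holds`, with the explicit constant
`c = 1/2400`.  Cell `crystal3d-full`, literature-typing layer D-0088 (4), seat `littype-FC1-1` (gen 11).
No new definitions of notions (the label sets and the test function below are proof devices), no named
facts, no `sorry`.

## Source, as printed

B. Schmidt, *Ground states of the 2D sticky disc model: fine properties and `N^{3/4}` law for the
deviation from the asymptotic Wulff shape*, J. Stat. Phys. **153** (2013) 727–738 [Schmidt2013], read on
the held arXiv text `paper:arxiv-1302.6513` (chunks p0007–p0008):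

* **Theorem 2.6.** "There exists a constant `c > 0`, independent of `N`, such that for infinitely many
  `N ∈ ℕ` there are two ground states `S_N'` and `S̃_N` with `N` atoms such that
  `inf{‖μ_N' − μ̃_N(R · + a)‖ : R ∈ O(2), a ∈ ℝ²} ≥ c N^{−1/4}`."
* Proof (p0008): `N = 3k(k+1) + 2`, `S_N' = (𝓛 ∩ conv(B₁,…,B₆)) ∪ {B₁ + e₁}` (the regular lattice hexagon
  plus one atom), `‖μ_N' − (2/√3)χ_{N^{−1/2}H}‖ ≤ C N^{−1/2}`; with `m = ⌊√(k/2)⌋` two bond-preserving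
  moves produce a ground state `S̃_N` whose shape is the distorted hexagon
  `H̃ = conv(B₁ − m e₂, B₂ − m e₂, B₃ − m e₁, B₄, B₅, B₆ + m(e₁ − e₂))`: "while all the segments of `∂H`
  are of equal length, those of `∂H̃` differ in length by an amount `≥ cm ≥ cN^{1/4}`. It is not hard to
  see that indeed `inf{|H △ (RH̃ + a)| : R ∈ O(2), a ∈ ℝ²} ≥ c N^{3/4}`. (Note e.g. that
  `diam(H̃) − diam(H) ≥ m/2`.) The assertion of the theorem now follows by rescaling."

## The proof formalised here (same architecture, certified last step)

For infinitely many `N` we exhibit, as in print, one near-regular and one elongated ground state and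
bound their flat distance from below uniformly over all rigid motions.

* **The elongated state** is the swept hexagon `D(a,L)` (`sweptHexagon`): the lattice hexagon
  `H_a = {|m|, |n|, |m+n| ≤ a}` swept by `L = ⌊√a⌋` unit steps along `e₁`
  (`N = #D = 3a² + 3a + 1 + L(2a+1)`, `card_sweptHexagon`).  It is 3-convex with `6a + 2L + 3 =
  ⌈√(12N − 3)⌉` lattice lines (`L² ≤ 3a`), hence an edge-isoperimetric minimizer by the converse line
  count criterion of `TriangularLatticeMaximalDeviation.lean` and so attains Harborth's bound
  (`adjCount_sweptHexagon`); its opposite long sides are `2a + L` apart along `e₁` against a width `2a`: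
  side lengths differing by `L ∼ N^{1/4}`, exactly the feature of the printed `H̃`.
* **The near-regular state** is Harborth's spiral configuration `H_{r−1} ∪ (a' labels of ring r)`,
  `N = 3r² − 3r + 1 + a'` (`HexagonalSpiral.lean`, `card_config`, `harborthNumber_of_ring`), which
  contains the regular hexagon `H_{r−1}` and is contained in `H_r` (the printed `S_N'` is the case
  `a' = 1`; a general `N = #D(a,L)` is not of the form `3k(k+1)+2`).
* Both label sets enumerate maximal unit-disc configurations (`isMaximalDiscConfig_labelConfig`:
  lattice labels are `1`-separated, and no hard configuration beats Harborth's bound —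
  `Harborth1974_contactNumber_holds`).
* **The last step.**  The remark on p0007 ("`|‖μ_N − μ‖ − ‖μ̃_N − μ‖_{L¹}| ≤ C N^{−1}` … both approaches
  will yield equivalent results") does not convert a symmetric-difference LOWER bound into a flat-norm
  lower bound (a `1`-Lipschitz test function localised on the strips `H △ (RH̃+a)`, of width `∼ N^{−1/4}`
  after rescaling, only reaches height `∼ N^{−1/4}` there, giving `N^{−1/2}`).  We certify the
  flat-norm bound directly with ONE admissible global test function: for a rigid motion `(R, a)` put
  `φ(p) = ¼ min(⟨p − a/√N, R e₂⟩², 4)` (`testFn`; `1`-Lipschitz, `0 ≤ φ ≤ 1`), a clipped second moment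
  across the long axis of the moved elongated state.  Then (§7)
  `∫ φ dμ̃_N(R · + a) ≤ (3/16) N⁻² Σ_{(m,n) ∈ D} n²`, while `∫ φ dμ_N' ≥ (3/16) N⁻² Σ_{(m,n) ∈ H_{r−1}} n²`
  if the hexagon `H_{r−1} ⊆ S_N'` lies in the slab `|⟨· − a/√N, Re₂⟩| ≤ 2` — by the ISOTROPY of the
  hexagon's second moments (`sum_hexagon_inner_sq`, from the label symmetries `(m,n) ↦ (n,m)`,
  `(m,n) ↦ (−m−n,n)`) and `Σ_{H} p = 0` — and `∫ φ dμ_N' ≥ 1/16` otherwise (the rescaled `S_N'` has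
  diameter `≤ 2r/√N ≤ 3/2`).  The exact row sums (§1, §2)
  `6 Σ_{H_k} n² = k(k+1)(5k²+5k+2)` and `6 Σ_{D(a,L)} n² = a(a+1)(5a²+5a+2+2L(2a+1))` differ by at least
  `a³L` when `N` lies in the `k`-th hexagonal shell (`k ≈ a + L/3`; `cube_mul_le_phi_sub_phi`), and
  `a³L/(32N²) ≥ N^{−1/4}/2400` (`rpow_neg_quarter_le`).  Hence
  `‖μ_N' − μ̃_N(R · + a)‖ ≥ ∫ φ d(μ_N' − μ̃_N(R · + a)) ≥ N^{−1/4}/2400` (`sub_le_flatNorm`, `main_estimate`).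

## Contents (namespace `Literature.MathematicalPhysics.StatisticalMechanics.Schmidt2013`)

§1 symmetric lattice sums (`six_mul_sum_Icc_sq`, row decomposition and symmetries of `H_k`);
§2 `sweptHexagon` (3-convexity, line count, cardinality, `Σ n²`, Harborth's bound);
§3 `labelConfig`, `isMaximalDiscConfig_labelConfig`; §4 the spiral configuration;
§5 `inner_triPoint`, `sum_hexagon_inner_sq` (isotropy), `sum_hexagon_inner_sub_sq_ge`;
§6 `testFn` (Lipschitz, bounds), `sub_le_flatNorm`; §7 the two empirical integrals;
§8 arithmetic; §9 `main_estimate`, **`Schmidt2013_deviationLowerBound_holds`**.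
-/

noncomputable section

open Finset

namespace Literature.MathematicalPhysics.StatisticalMechanics.Schmidt2013

open Literature.Geometry.DiscreteGeometry.HarborthSpiral (hexagon mem_hexagon Inside)

/-! ## §1 Lattice sums over symmetric rows -/

/-- Peeling the two extreme terms of a sum over `[-(m+1), m+1] ⊂ ℤ`. [folklore] -/
private theorem sum_Icc_neg_succ (f : ℤ → ℝ) (m : ℕ) :
    ∑ y ∈ Icc (-((m : ℤ) + 1)) ((m : ℤ) + 1), f y =
      ∑ y ∈ Icc (-(m : ℤ)) m, f y + f ((m : ℤ) + 1) + f (-((m : ℤ) + 1)) := by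
  have h : Icc (-((m : ℤ) + 1)) ((m : ℤ) + 1) =
      insert (-((m : ℤ) + 1)) (insert ((m : ℤ) + 1) (Icc (-(m : ℤ)) m)) := by
    ext y; simp only [mem_Icc, mem_insert]; omega
  rw [h, sum_insert, sum_insert]
  · ring
  · simp only [mem_Icc]; omega
  · simp only [mem_insert, mem_Icc]; omega

/-- **Closed form of the symmetric second-moment sum** `G(m,c) = Σ_{|y| ≤ m} (c − |y|) y²`:
`6 G(m,c) = m(m+1)(2c(2m+1) − 3m(m+1))` (Faulhaber for `Σ t²`, `Σ t³`). [folklore] -/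
private theorem six_mul_sum_Icc_sq (c : ℝ) (m : ℕ) :
    6 * ∑ y ∈ Icc (-(m : ℤ)) m, (c - |(y : ℝ)|) * (y : ℝ) ^ 2 =
      (m : ℝ) * (m + 1) * (2 * c * (2 * m + 1) - 3 * m * (m + 1)) := by
  induction m with
  | zero => simp
  | succ m ih =>
    have h := sum_Icc_neg_succ (fun y : ℤ => (c - |(y : ℝ)|) * (y : ℝ) ^ 2) m
    push_cast at h ⊢
    rw [h]
    have e1 : |((m : ℝ) + 1)| = m + 1 := abs_of_nonneg (by positivity)
    have e2 : |(-((m : ℝ) + 1))| = m + 1 := by rw [abs_neg, e1]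
    rw [e1, e2]
    linear_combination ih

/-- A sum of an odd function over `[-m, m] ⊂ ℤ` vanishes. [folklore] -/
private theorem sum_Icc_neg_eq_zero_of_odd (f : ℤ → ℝ) (hf : ∀ y, f (-y) = -f y) (m : ℕ) :
    ∑ y ∈ Icc (-(m : ℤ)) m, f y = 0 := by
  induction m with
  | zero =>
    have h0 : f 0 = 0 := by have := hf 0; simp at this; linarith
    simpa using h0
  | succ m ih =>
    have h := sum_Icc_neg_succ f m
    push_cast at h ⊢
    rw [h, ih, hf]; ring

/-- Fubini for a filtered product of finsets: sum row by row. [folklore] -/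
private theorem sum_filter_product_rows (s t : Finset ℤ) (P : ℤ × ℤ → Prop) [DecidablePred P]
    (g : ℤ × ℤ → ℝ) :
    ∑ p ∈ (s ×ˢ t).filter P, g p = ∑ y ∈ t, ∑ x ∈ s.filter (fun x => P (x, y)), g (x, y) := by
  rw [sum_filter, sum_product_right]
  refine sum_congr rfl fun y _ => ?_
  rw [sum_filter]

/-- A row of the lattice hexagon `H_k`: the labels `(m, n) ∈ H_k` with fixed `n`, `|n| ≤ k`, number
`2k + 1 − |n|`. [cite: HeitmannRadin1980, §3 (p. 283)] -/
theorem card_row_hexagon {k : ℕ} {n : ℤ} (hn : -(k : ℤ) ≤ n) (hn' : n ≤ k) :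
    (((Icc (-(k : ℤ)) k).filter fun m => Inside k (m, n)).card : ℤ) = 2 * k + 1 - |n| := by
  have h : (Icc (-(k : ℤ)) k).filter (fun m => Inside k (m, n)) =
      Icc (max (-(k : ℤ)) (-k - n)) (min (k : ℤ) (k - n)) := by
    ext m
    simp only [mem_filter, mem_Icc, Inside, max_le_iff, le_min_iff]
    omega
  rw [h, Int.card_Icc]
  rcases abs_cases n with ⟨h1, _⟩ | ⟨h1, _⟩ <;> omega

/-- **Row decomposition of sums over `H_k`** of functions of the row index.
[cite: HeitmannRadin1980, §3 (p. 283)] -/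
theorem sum_hexagon_snd (k : ℕ) (g : ℤ → ℝ) :
    ∑ q ∈ hexagon k, g q.2 = ∑ n ∈ Icc (-(k : ℤ)) k, (2 * k + 1 - |(n : ℝ)|) * g n := by
  unfold hexagon
  rw [sum_filter_product_rows]
  refine sum_congr rfl fun n hn => ?_
  rw [mem_Icc] at hn
  dsimp only
  rw [sum_const, nsmul_eq_mul]
  congr 1
  have := card_row_hexagon hn.1 hn.2
  exact_mod_cast this

/-- `6 Σ_{(m,n) ∈ H_k} n² = k(k+1)(5k² + 5k + 2)`. [folklore] -/
private theorem six_mul_sum_hexagon_snd_sq (k : ℕ) :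
    6 * ∑ q ∈ hexagon k, ((q.2 : ℝ)) ^ 2 = (k : ℝ) * (k + 1) * (5 * (k : ℝ) ^ 2 + 5 * k + 2) := by
  rw [sum_hexagon_snd k (fun n => ((n : ℝ)) ^ 2), six_mul_sum_Icc_sq]
  ring

/-- Re-indexing a sum over a finset by an involution preserving it. [folklore] -/
private theorem sum_comp_eq_of_involutive {S : Finset (ℤ × ℤ)} {σ : ℤ × ℤ → ℤ × ℤ} (hσ : ∀ q, σ (σ q) = q)
    (hmem : ∀ q ∈ S, σ q ∈ S) (f : ℤ × ℤ → ℝ) :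
    ∑ q ∈ S, f (σ q) = ∑ q ∈ S, f q := by
  have himg : S.image σ = S := by
    ext q
    constructor
    · intro hq
      obtain ⟨p, hp, rfl⟩ := mem_image.1 hq
      exact hmem p hp
    · intro hq
      exact mem_image.2 ⟨σ q, hmem q hq, hσ q⟩
  have hinj : Set.InjOn σ ↑S := fun a _ b _ h => by rw [← hσ a, ← hσ b, h]
  rw [← sum_image hinj, himg]

/-- `H_k` is symmetric under `(m,n) ↦ (n,m)`. [cite: HeitmannRadin1980, §3 (p. 283)] -/
theorem swap_mem_hexagon {k : ℕ} {q : ℤ × ℤ} (hq : q ∈ hexagon k) : (q.2, q.1) ∈ hexagon k := by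
  rw [mem_hexagon] at hq ⊢; unfold Inside at hq ⊢; dsimp only at hq ⊢; omega

/-- `H_k` is symmetric under the reflection `(m,n) ↦ (−m−n, n)`. [cite: HeitmannRadin1980, §3 (p. 283)] -/
theorem shear_mem_hexagon {k : ℕ} {q : ℤ × ℤ} (hq : q ∈ hexagon k) : (-q.1 - q.2, q.2) ∈ hexagon k := by
  rw [mem_hexagon] at hq ⊢; unfold Inside at hq ⊢; dsimp only at hq ⊢; omega

/-- `H_k` is symmetric under `q ↦ −q`. [cite: HeitmannRadin1980, §3 (p. 283)] -/
theorem neg_mem_hexagon {k : ℕ} {q : ℤ × ℤ} (hq : q ∈ hexagon k) : -q ∈ hexagon k := by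
  rw [mem_hexagon] at hq ⊢; unfold Inside at hq ⊢
  simp only [Prod.fst_neg, Prod.snd_neg] at hq ⊢; omega

/-- `Σ_{H_k} m² = Σ_{H_k} n²`. [folklore] -/
private theorem sum_hexagon_fst_sq (k : ℕ) :
    ∑ q ∈ hexagon k, ((q.1 : ℝ)) ^ 2 = ∑ q ∈ hexagon k, ((q.2 : ℝ)) ^ 2 := by
  rw [← sum_comp_eq_of_involutive (σ := fun q : ℤ × ℤ => (q.2, q.1)) (fun q => rfl)
    (fun q hq => swap_mem_hexagon hq) (fun q => ((q.1 : ℝ)) ^ 2)]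

/-- `2 Σ_{H_k} m n = −Σ_{H_k} n²` (from the symmetry `(m,n) ↦ (−m−n, n)`). [folklore] -/
private theorem two_mul_sum_hexagon_fst_mul_snd (k : ℕ) :
    2 * ∑ q ∈ hexagon k, ((q.1 : ℝ)) * q.2 = -∑ q ∈ hexagon k, ((q.2 : ℝ)) ^ 2 := by
  have h := sum_comp_eq_of_involutive (S := hexagon k) (σ := fun q : ℤ × ℤ => (-q.1 - q.2, q.2))
    (fun q => by obtain ⟨m, n⟩ := q; refine Prod.ext ?_ rfl; dsimp only; ring) (fun q hq => shear_mem_hexagon hq)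
    (fun q => ((q.1 : ℝ)) * q.2)
  simp only [Int.cast_sub, Int.cast_neg] at h
  have e : ∑ q ∈ hexagon k, (-(q.1 : ℝ) - q.2) * q.2 =
      -∑ q ∈ hexagon k, ((q.1 : ℝ)) * q.2 - ∑ q ∈ hexagon k, ((q.2 : ℝ)) ^ 2 := by
    rw [← sum_neg_distrib, ← sum_sub_distrib]
    exact sum_congr rfl fun q _ => by ring
  linarith

/-- `Σ_{H_k} m = 0` and `Σ_{H_k} n = 0`. [folklore] -/
private theorem sum_hexagon_fst (k : ℕ) : ∑ q ∈ hexagon k, ((q.1 : ℝ)) = 0 := by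
  have h := sum_comp_eq_of_involutive (S := hexagon k) (σ := fun q : ℤ × ℤ => -q)
    (fun q => neg_neg q) (fun q hq => neg_mem_hexagon hq) (fun q => ((q.1 : ℝ)))
  simp only [Prod.fst_neg, Int.cast_neg, sum_neg_distrib] at h
  linarith

/-- `Σ_{H_k} n = 0`. [folklore] -/
private theorem sum_hexagon_snd' (k : ℕ) : ∑ q ∈ hexagon k, ((q.2 : ℝ)) = 0 := by
  have h := sum_comp_eq_of_involutive (S := hexagon k) (σ := fun q : ℤ × ℤ => -q)
    (fun q => neg_neg q) (fun q hq => neg_mem_hexagon hq) (fun q => ((q.2 : ℝ)))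
  simp only [Prod.snd_neg, Int.cast_neg, sum_neg_distrib] at h
  linarith


/-- `Σ_{|y| ≤ m} (c − |y|) = (2m+1)c − m(m+1)`. [folklore] -/
private theorem sum_Icc_sub_abs (c : ℝ) (m : ℕ) :
    ∑ y ∈ Icc (-(m : ℤ)) m, (c - |(y : ℝ)|) = (2 * m + 1) * c - m * (m + 1) := by
  induction m with
  | zero => simp
  | succ m ih =>
    have h := sum_Icc_neg_succ (fun y : ℤ => (c - |(y : ℝ)|)) m
    push_cast at h ⊢
    rw [h, ih]
    have e1 : |((m : ℝ) + 1)| = m + 1 := abs_of_nonneg (by positivity)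
    have e2 : |(-((m : ℝ) + 1))| = m + 1 := by rw [abs_neg, e1]
    rw [e1, e2]
    ring

/-! ## §2 The swept hexagon `D(a,L)`: an elongated edge-isoperimetric minimizer -/

open Literature.Geometry.DiscreteGeometry (harborthNumber adjCount_le_two_mul_harborthNumber
  contactPairCount IsMaximalDiscConfig pairwise_one_le_dist_triPoint two_mul_contactPairCount_triPoint
  contactPairCount_le_harborthNumber)
open Literature.Geometry.DiscreteGeometry.HarborthSpiral (adjCount rot6 rot6inv IsRowConvex lineCount
  IsTriConvex mem_image_rot6 image_snd_image_rot6 image_snd_image_rot6_rot6 config mem_config card_config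
  harborthNumber_of_ring ringContacts)
open DavoliPiovanoStefanelli2017 (isTriMinimizer_of_lineCount_eq isTriMinimizer_image_triPoint_iff)
open Theil2006 (Plane triPoint triPoint_injective)

/-- **The swept hexagon `D(a,L)`**: the lattice hexagon `H_a = {|m|, |n|, |m+n| ≤ a}` swept by `L`
unit steps along `e₁` — labels `(m, n)` with `|n| ≤ a`, `−a ≤ m ≤ a + L`, `−a ≤ m + n ≤ a + L`.
For `L² ≤ 3a` it is an elongated ground state (an EIP minimizer, `adjCount_sweptHexagon`), the
analogue of Schmidt's distorted hexagon `H̃` (side lengths differing by `∼ N^{1/4}`).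
[cite: Schmidt2013, Theorem 2.6 and its proof (arXiv text p0007–p0008)] -/
def sweptHexagon (a L : ℕ) : Finset (ℤ × ℤ) :=
  ((Icc (-(a : ℤ)) (a + L)) ×ˢ (Icc (-(a : ℤ)) a)).filter fun p =>
    -(a : ℤ) ≤ p.1 + p.2 ∧ p.1 + p.2 ≤ a + L

/-- Membership in `D(a,L)`. [cite: Schmidt2013, Theorem 2.6 (p0007–p0008)] -/
theorem mem_sweptHexagon {a L : ℕ} {p : ℤ × ℤ} :
    p ∈ sweptHexagon a L ↔ (-(a : ℤ) ≤ p.1 ∧ p.1 ≤ a + L) ∧ (-(a : ℤ) ≤ p.2 ∧ p.2 ≤ a) ∧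
      (-(a : ℤ) ≤ p.1 + p.2 ∧ p.1 + p.2 ≤ a + L) := by
  simp only [sweptHexagon, mem_filter, mem_product, mem_Icc, and_assoc]

/-- `D(a,L)` is 3-convex. [cite: DavoliPiovanoStefanelli2017, Definition 3.2 p. 643] -/
theorem isTriConvex_sweptHexagon (a L : ℕ) : IsTriConvex (sweptHexagon a L) := by
  refine ⟨?_, ?_, ?_⟩
  · intro t u w v hu hv huw hwv
    rw [mem_sweptHexagon] at hu hv ⊢
    dsimp only at hu hv ⊢
    omega
  · intro t u w v hu hv huw hwv
    rw [mem_image_rot6, mem_sweptHexagon] at hu hv ⊢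
    simp only [rot6inv] at hu hv ⊢
    omega
  · intro t u w v hu hv huw hwv
    rw [mem_image_rot6, mem_image_rot6, mem_sweptHexagon] at hu hv ⊢
    simp only [rot6inv] at hu hv ⊢
    omega

/-- The rows of `D(a,L)` are `−a, …, a`. [cite: Schmidt2013, Theorem 2.6 (p0007–p0008)] -/
theorem image_snd_sweptHexagon (a L : ℕ) :
    (sweptHexagon a L).image Prod.snd = Icc (-(a : ℤ)) a := by
  ext y
  rw [mem_Icc]
  constructor
  · intro hy
    obtain ⟨p, hp, rfl⟩ := mem_image.1 hy
    rw [mem_sweptHexagon] at hp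
    omega
  · intro hy
    refine mem_image.2 ⟨(0, y), ?_, rfl⟩
    rw [mem_sweptHexagon]; dsimp only; omega

/-- The columns of `D(a,L)` are `−a, …, a + L`. [cite: Schmidt2013, Theorem 2.6 (p0007–p0008)] -/
theorem image_fst_sweptHexagon (a L : ℕ) :
    (sweptHexagon a L).image Prod.fst = Icc (-(a : ℤ)) (a + L) := by
  ext x
  rw [mem_Icc]
  constructor
  · intro hx
    obtain ⟨p, hp, rfl⟩ := mem_image.1 hx
    rw [mem_sweptHexagon] at hp
    omega
  · intro hx
    refine mem_image.2 ⟨(x, 0), ?_, rfl⟩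
    rw [mem_sweptHexagon]; dsimp only; omega

/-- The diagonals `m + n = s` of `D(a,L)` are `s = −a, …, a + L`. [cite: Schmidt2013, Theorem 2.6 (p0007–p0008)] -/
theorem image_sum_sweptHexagon (a L : ℕ) :
    ((sweptHexagon a L).image fun q => q.1 + q.2) = Icc (-(a : ℤ)) (a + L) := by
  ext s
  rw [mem_Icc]
  constructor
  · intro hs
    obtain ⟨p, hp, rfl⟩ := mem_image.1 hs
    rw [mem_sweptHexagon] at hp
    omega
  · intro hs
    refine mem_image.2 ⟨(s, 0), ?_, by simp⟩
    rw [mem_sweptHexagon]; dsimp only; omega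

/-- **`D(a,L)` meets `6a + 2L + 3` lattice lines.** [cite: DavoliPiovanoStefanelli2017, (10) p. 630] -/
theorem lineCount_sweptHexagon (a L : ℕ) : lineCount (sweptHexagon a L) = 6 * a + 2 * L + 3 := by
  unfold lineCount
  rw [image_snd_image_rot6, image_snd_image_rot6_rot6, image_snd_sweptHexagon, image_sum_sweptHexagon,
    image_fst_sweptHexagon]
  simp only [Int.card_Icc]
  omega

/-- A row of `D(a,L)` has `2a + L + 1 − |n|` labels. [cite: Schmidt2013, Theorem 2.6 (p0007–p0008)] -/
theorem card_row_sweptHexagon {a L : ℕ} {n : ℤ} (hn : -(a : ℤ) ≤ n) (hn' : n ≤ a) :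
    (((Icc (-(a : ℤ)) (a + L)).filter fun m => -(a : ℤ) ≤ m + n ∧ m + n ≤ a + L).card : ℤ) =
      2 * a + L + 1 - |n| := by
  have h : (Icc (-(a : ℤ)) (a + L)).filter (fun m => -(a : ℤ) ≤ m + n ∧ m + n ≤ a + L) =
      Icc (max (-(a : ℤ)) (-a - n)) (min ((a : ℤ) + L) (a + L - n)) := by
    ext m
    simp only [mem_filter, mem_Icc, max_le_iff, le_min_iff]
    omega
  rw [h, Int.card_Icc]
  rcases abs_cases n with ⟨h1, _⟩ | ⟨h1, _⟩ <;> omega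

/-- **Row decomposition of sums over `D(a,L)`** of functions of the row index.
[cite: Schmidt2013, Theorem 2.6 (p0007–p0008)] -/
theorem sum_sweptHexagon_snd (a L : ℕ) (g : ℤ → ℝ) :
    ∑ q ∈ sweptHexagon a L, g q.2 = ∑ n ∈ Icc (-(a : ℤ)) a, (2 * a + L + 1 - |(n : ℝ)|) * g n := by
  unfold sweptHexagon
  rw [sum_filter_product_rows]
  refine sum_congr rfl fun n hn => ?_
  rw [mem_Icc] at hn
  dsimp only
  rw [sum_const, nsmul_eq_mul]
  congr 1
  have := card_row_sweptHexagon (L := L) hn.1 hn.2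
  exact_mod_cast this

/-- **`#D(a,L) = 3a² + 3a + 1 + L(2a + 1)`** (the hexagon `H_a` plus `L` swept rows of `2a+1`).
[cite: Schmidt2013, Theorem 2.6 (p0007–p0008)] -/
theorem card_sweptHexagon (a L : ℕ) :
    (sweptHexagon a L).card = 3 * a ^ 2 + 3 * a + 1 + L * (2 * a + 1) := by
  have h : ((sweptHexagon a L).card : ℝ) = 3 * (a : ℝ) ^ 2 + 3 * a + 1 + L * (2 * a + 1) := by
    have e : ((sweptHexagon a L).card : ℝ) = ∑ q ∈ sweptHexagon a L, (fun _ : ℤ => (1 : ℝ)) q.2 := by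
      simp
    rw [e, sum_sweptHexagon_snd a L (fun _ => (1 : ℝ))]
    simp only [mul_one]
    rw [sum_Icc_sub_abs]
    ring
  exact_mod_cast h

/-- `6 Σ_{(m,n) ∈ D(a,L)} n² = a(a+1)(5a² + 5a + 2 + 2L(2a+1))`. [folklore] -/
private theorem six_mul_sum_sweptHexagon_snd_sq (a L : ℕ) :
    6 * ∑ q ∈ sweptHexagon a L, ((q.2 : ℝ)) ^ 2 =
      (a : ℝ) * (a + 1) * (5 * (a : ℝ) ^ 2 + 5 * a + 2 + 2 * L * (2 * a + 1)) := by
  rw [sum_sweptHexagon_snd a L (fun n => ((n : ℝ)) ^ 2), six_mul_sum_Icc_sq]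
  ring

/-- **`⌈√(12 #D(a,L) − 3)⌉ = 6a + 2L + 3` when `L² ≤ 3a`**: `12N − 3 = (6a+3)² + 12L(2a+1)` lies in
`((6a+2L+2)², (6a+2L+3)²]`. [cite: DavoliPiovanoStefanelli2017, (12) p. 630] -/
theorem ceil_sqrt_card_sweptHexagon {a L : ℕ} (hL : L * L ≤ 3 * a) :
    ⌈Real.sqrt (12 * ((sweptHexagon a L).card : ℝ) - 3)⌉ = 6 * (a : ℤ) + 2 * L + 3 := by
  have hLr : (L : ℝ) * L ≤ 3 * a := by exact_mod_cast hL
  rw [card_sweptHexagon, Int.ceil_eq_iff]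
  push_cast
  constructor
  · rw [show (6 * (a : ℝ) + 2 * L + 3 - 1) = 6 * a + 2 * L + 2 by ring, Real.lt_sqrt (by positivity)]
    nlinarith
  · rw [Real.sqrt_le_left (by positivity)]
    nlinarith

/-- **`D(a,L)` attains Harborth's bound** (`2 · bonds = 2[3N − √(12N−3)]`) for `L² ≤ 3a`: it is 3-convex
with `⌈√(12N−3)⌉` lattice lines. [cite: DavoliPiovanoStefanelli2017, (10)–(12) p. 630] -/
theorem adjCount_sweptHexagon {a L : ℕ} (hL : L * L ≤ 3 * a) :
    (adjCount (sweptHexagon a L) : ℤ) = 2 * harborthNumber (sweptHexagon a L).card := by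
  refine le_antisymm (adjCount_le_two_mul_harborthNumber _) ?_
  rw [← isTriMinimizer_image_triPoint_iff]
  refine isTriMinimizer_of_lineCount_eq (isTriConvex_sweptHexagon a L) ?_
  rw [ceil_sqrt_card_sweptHexagon hL, lineCount_sweptHexagon]
  push_cast
  ring

/-! ## §3 From label sets to labelled maximal disc configurations -/

/-- The labelled configuration `Fin N → ℝ²` of a finset `S` of `N` lattice labels (an enumeration of
`triPoint(S)`). [cite: Schmidt2013, Theorem 2.1 and §2 (p0005)] -/
def labelConfig (S : Finset (ℤ × ℤ)) {N : ℕ} (h : S.card = N) : Fin N → Plane :=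
  fun i => triPoint (((S.equivFinOfCardEq h).symm i : S) : ℤ × ℤ)

/-- The labels of `labelConfig S` are injective. [folklore] -/
private theorem labelConfig_labels_injective (S : Finset (ℤ × ℤ)) {N : ℕ} (h : S.card = N) :
    Function.Injective fun i : Fin N => (((S.equivFinOfCardEq h).symm i : S) : ℤ × ℤ) :=
  fun _ _ hij => (S.equivFinOfCardEq h).symm.injective (Subtype.val_injective hij)

/-- Sums over the labelled configuration are sums over the label set. [folklore] -/
private theorem sum_labelConfig (S : Finset (ℤ × ℤ)) {N : ℕ} (h : S.card = N) (g : Plane → ℝ) :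
    ∑ i : Fin N, g (labelConfig S h i) = ∑ q ∈ S, g (triPoint q) := by
  unfold labelConfig
  rw [Equiv.sum_comp (S.equivFinOfCardEq h).symm (fun s : S => g (triPoint (s : ℤ × ℤ))),
    Finset.sum_coe_sort S (fun q => g (triPoint q))]

/-- Every point of `labelConfig S` is `triPoint q` for some `q ∈ S`. [folklore] -/
private theorem exists_labelConfig_eq (S : Finset (ℤ × ℤ)) {N : ℕ} (h : S.card = N) (i : Fin N) :
    ∃ q ∈ S, labelConfig S h i = triPoint q :=
  ⟨_, ((S.equivFinOfCardEq h).symm i).2, rfl⟩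

/-- **A label set attaining Harborth's bound enumerates a sticky-disc ground state**: if
`adjCount S = 2[3N − √(12N−3)]` then `labelConfig S` is a maximal disc configuration (hard core by
the lattice; no hard configuration of `N` unit discs has more contacts, Harborth 1974).
[cite: Schmidt2013, Theorem 2.1 (p0005)] [cite: Harborth1974, (5)–(6)] -/
theorem isMaximalDiscConfig_labelConfig {S : Finset (ℤ × ℤ)} {N : ℕ} (h : S.card = N)
    (hadj : (adjCount S : ℤ) = 2 * harborthNumber N) : IsMaximalDiscConfig (labelConfig S h) := by
  classical
  set c : Fin N → ℤ × ℤ := fun i => (((S.equivFinOfCardEq h).symm i : S) : ℤ × ℤ) with hc_def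
  have hc : Function.Injective c := labelConfig_labels_injective S h
  have himage : univ.image c = S := by
    ext q
    simp only [mem_image, mem_univ, true_and, c]
    constructor
    · rintro ⟨i, rfl⟩
      exact ((S.equivFinOfCardEq h).symm i).2
    · intro hq
      exact ⟨S.equivFinOfCardEq h ⟨q, hq⟩, by simp⟩
  have hx : labelConfig S h = fun i => triPoint (c i) := rfl
  refine ⟨by rw [hx]; exact pairwise_one_le_dist_triPoint hc, fun y hy => ?_⟩
  have h3 := two_mul_contactPairCount_triPoint c hc
  rw [himage] at h3
  have h3' : (2 * contactPairCount (fun i => triPoint (c i)) : ℤ) = adjCount S := by exact_mod_cast h3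
  have hub := contactPairCount_le_harborthNumber y hy
  have : (contactPairCount y : ℤ) ≤ contactPairCount (labelConfig S h) := by rw [hx]; linarith
  exact_mod_cast this

/-! ## §4 The near-regular ground state: Harborth's spiral configuration -/

/-- Every `N ≥ 1` is `3r² − 3r + 1 + a` with `r ≥ 1`, `0 ≤ a < 6r` (hexagon `H_{r−1}` plus `a` labels
of ring `r`). [cite: Harborth1974, (6)] -/
theorem exists_ring_decomposition {N : ℕ} (hN : 1 ≤ N) :
    ∃ r a : ℕ, 1 ≤ r ∧ a < 6 * r ∧ (N : ℤ) = 3 * r ^ 2 - 3 * r + 1 + a := by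
  induction N, hN using Nat.le_induction with
  | base => exact ⟨1, 0, le_rfl, by omega, by norm_num⟩
  | succ N hN ih =>
    obtain ⟨r, a, hr, ha, h⟩ := ih
    by_cases h' : a + 1 < 6 * r
    · exact ⟨r, a + 1, hr, h', by push_cast; rw [h]; ring⟩
    · refine ⟨r + 1, 0, by omega, by omega, ?_⟩
      have h6 : (a : ℤ) + 1 = 6 * r := by exact_mod_cast (show a + 1 = 6 * r by omega)
      push_cast
      rw [h]
      linear_combination h6

/-- **The spiral configuration `H_{r−1} ∪ (a labels of ring r)` has `N` labels and attains Harborth's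
bound** (`card_config`, `harborthNumber_of_ring`). [cite: Harborth1974, (6)] -/
theorem card_config_eq_and_adjCount {N r a : ℕ} (hr : 1 ≤ r) (ha : a < 6 * r)
    (hN : (N : ℤ) = 3 * r ^ 2 - 3 * r + 1 + a) :
    (config r a).card = N ∧ (adjCount (config r a) : ℤ) = 2 * harborthNumber N := by
  obtain ⟨h1, h2⟩ := card_config hr ha.le
  refine ⟨?_, ?_⟩
  · have : ((config r a).card : ℤ) = N := by rw [h1, hN]
    exact_mod_cast this
  · rw [h2, harborthNumber_of_ring hr ha hN]

/-- `H_{r−1} ⊆` spiral configuration. [cite: Harborth1974, (6)] -/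
theorem hexagon_subset_config {r : ℕ} (hr : 1 ≤ r) (a : ℕ) : hexagon (r - 1) ⊆ config r a := by
  intro q hq
  rw [mem_hexagon] at hq
  rw [mem_config]
  left
  have : (((r - 1 : ℕ) : ℤ)) = (r : ℤ) - 1 := by push_cast [Nat.cast_sub hr]; ring
  rwa [this] at hq

/-- Spiral configuration `⊆ H_r`. [cite: Harborth1974, (6)] -/
theorem config_subset_hexagon (r a : ℕ) : config r a ⊆ hexagon r := by
  intro q hq
  unfold config at hq
  exact mem_of_mem_filter q hq


/-! ## §5 Second moments: isotropy of the hexagon, the thin direction of `D(a,L)` -/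

open scoped RealInnerProductSpace

/-- `⟨m e₁ + n e₂, v⟩ = (m + n/2) v₀ + (√3/2) n v₁`. [folklore] -/
private theorem inner_triPoint (q : ℤ × ℤ) (v : Plane) :
    ⟪triPoint q, v⟫ = ((q.1 : ℝ) + (q.2 : ℝ) / 2) * v 0 + Real.sqrt 3 / 2 * (q.2 : ℝ) * v 1 := by
  have h : ⟪triPoint q, v⟫ = triPoint q 0 * v 0 + triPoint q 1 * v 1 := by
    simp [PiLp.inner_apply, Fin.sum_univ_two, mul_comm]
  rw [h, Theil2006.triPoint_apply_zero, Theil2006.triPoint_apply_one]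

/-- `‖v‖² = v₀² + v₁²` in `ℝ²`. [folklore] -/
private theorem norm_sq_eq_add (v : Plane) : ‖v‖ ^ 2 = v 0 ^ 2 + v 1 ^ 2 := by
  rw [EuclideanSpace.real_norm_sq_eq, Fin.sum_univ_two]

/-- **Isotropy of the lattice hexagon**: `Σ_{q ∈ H_k} ⟨triPoint q, v⟩² = ¾ Σ_{(m,n) ∈ H_k} n²` for every
unit vector `v` (the second-moment tensor of a `6`-fold symmetric point set is scalar; here from the
label symmetries `(m,n) ↦ (n,m)` and `(m,n) ↦ (−m−n, n)`). [folklore] -/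
private theorem sum_hexagon_inner_sq (k : ℕ) {v : Plane} (hv : ‖v‖ = 1) :
    ∑ q ∈ hexagon k, ⟪triPoint q, v⟫ ^ 2 = 3 / 4 * ∑ q ∈ hexagon k, ((q.2 : ℝ)) ^ 2 := by
  have h3 : Real.sqrt 3 ^ 2 = 3 := Real.sq_sqrt (by norm_num)
  have hv2 : v 0 ^ 2 + v 1 ^ 2 = 1 := by rw [← norm_sq_eq_add, hv, one_pow]
  have expand : ∀ q : ℤ × ℤ, ⟪triPoint q, v⟫ ^ 2 =
      v 0 ^ 2 * ((q.1 : ℝ)) ^ 2 + (v 0 ^ 2 + Real.sqrt 3 * v 0 * v 1) * (((q.1 : ℝ)) * q.2) +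
        (v 0 ^ 2 / 4 + Real.sqrt 3 / 2 * v 0 * v 1 + 3 / 4 * v 1 ^ 2) * ((q.2 : ℝ)) ^ 2 := by
    intro q
    rw [inner_triPoint]
    linear_combination (((q.2 : ℝ)) ^ 2 * v 1 ^ 2 / 4) * h3
  rw [sum_congr rfl fun q _ => expand q, sum_add_distrib, sum_add_distrib, ← mul_sum, ← mul_sum,
    ← mul_sum, sum_hexagon_fst_sq]
  have h12 := two_mul_sum_hexagon_fst_mul_snd k
  set T2 := ∑ q ∈ hexagon k, ((q.2 : ℝ)) ^ 2
  set T12 := ∑ q ∈ hexagon k, ((q.1 : ℝ)) * q.2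
  have e12 : T12 = -T2 / 2 := by linarith
  rw [e12]
  linear_combination (3 / 4 * T2) * hv2

/-- `Σ_{q ∈ H_k} ⟨triPoint q, v⟩ = 0` (the hexagon is centrally symmetric). [folklore] -/
private theorem sum_hexagon_inner (k : ℕ) (v : Plane) : ∑ q ∈ hexagon k, ⟪triPoint q, v⟫ = 0 := by
  simp_rw [inner_triPoint]
  rw [sum_add_distrib, ← sum_mul, ← sum_mul, sum_add_distrib, sum_hexagon_fst, ← sum_div,
    sum_hexagon_snd', ← mul_sum, sum_hexagon_snd']
  ring

/-- **Lower bound for the second moment of the hexagon about any axis**: for a unit vector `v`,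
any `b` and any scale `c`, `Σ_{q ∈ H_k} ⟨c · triPoint q − b, v⟩² ≥ c² · ¾ Σ_{H_k} n²`.
[cite: Schmidt2013, Theorem 2.6 (p0007–p0008)] -/
theorem sum_hexagon_inner_sub_sq_ge (k : ℕ) {v : Plane} (hv : ‖v‖ = 1) (b : Plane) (c : ℝ) :
    c ^ 2 * (3 / 4 * ∑ q ∈ hexagon k, ((q.2 : ℝ)) ^ 2) ≤
      ∑ q ∈ hexagon k, ⟪c • triPoint q - b, v⟫ ^ 2 := by
  have expand : ∀ q : ℤ × ℤ, ⟪c • triPoint q - b, v⟫ ^ 2 =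
      c ^ 2 * ⟪triPoint q, v⟫ ^ 2 + (-(2 * c * ⟪b, v⟫)) * ⟪triPoint q, v⟫ + ⟪b, v⟫ ^ 2 := by
    intro q
    rw [inner_sub_left, real_inner_smul_left]
    ring
  rw [sum_congr rfl fun q _ => expand q, sum_add_distrib, sum_add_distrib, ← mul_sum, ← mul_sum,
    sum_hexagon_inner_sq k hv, sum_hexagon_inner, sum_const, nsmul_eq_mul]
  nlinarith [sq_nonneg ⟪b, v⟫, (hexagon k).card.cast_nonneg (α := ℝ)]

/-! ## §6 The test function and the flat-norm lower bound -/

/-- `|min(s², 4) − min(t², 4)| ≤ 4|s − t|`. [folklore] -/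
private theorem abs_min_sq_four_sub_le (s t : ℝ) : |min (s ^ 2) 4 - min (t ^ 2) 4| ≤ 4 * |s - t| := by
  have key : ∀ u : ℝ, min (u ^ 2) 4 = (min |u| 2) ^ 2 := by
    intro u
    rcases le_or_gt |u| 2 with h | h
    · rw [min_eq_left h, sq_abs, min_eq_left (by nlinarith [abs_nonneg u, sq_abs u])]
    · rw [min_eq_right h.le, min_eq_right (by nlinarith [abs_nonneg u, sq_abs u])]; norm_num
  rw [key s, key t]
  have hAB : |min |s| 2 - min |t| 2| ≤ |s - t| := by
    calc |min |s| 2 - min |t| 2| ≤ max |(|s| - |t|)| |((2 : ℝ) - 2)| := abs_min_sub_min_le_max _ _ _ _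
      _ = |(|s| - |t|)| := by simp [abs_nonneg]
      _ ≤ |s - t| := abs_abs_sub_abs_le_abs_sub s t
  have e : (min |s| 2) ^ 2 - (min |t| 2) ^ 2 = (min |s| 2 - min |t| 2) * (min |s| 2 + min |t| 2) := by
    ring
  have hA0 : 0 ≤ min |s| 2 := le_min (abs_nonneg s) (by norm_num)
  have hB0 : 0 ≤ min |t| 2 := le_min (abs_nonneg t) (by norm_num)
  have hA2 : min |s| 2 ≤ 2 := min_le_right _ _
  have hB2 : min |t| 2 ≤ 2 := min_le_right _ _
  rw [e, abs_mul, abs_of_nonneg (by linarith : 0 ≤ min |s| 2 + min |t| 2)]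
  calc |min |s| 2 - min |t| 2| * (min |s| 2 + min |t| 2) ≤ |s - t| * 4 :=
        mul_le_mul hAB (by linarith) (by linarith) (abs_nonneg _)
    _ = 4 * |s - t| := by ring

/-- **The test function** `φ_{b,v}(p) = ¼ min(⟨p − b, v⟩², 4)`: a clipped squared distance to the line
through `b` normal to `v` — `1`-Lipschitz with `0 ≤ φ ≤ 1` for `|v| = 1`, hence admissible in the flat
norm `‖μ‖ = sup{∫φ dμ : Lip φ ≤ 1, |φ| ≤ 1}`. (Replaces the symmetric-difference estimate of the printed
sketch: a second moment, unlike `|H △ (RH̃ + a)|`, is controlled by the flat norm.)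
[cite: Schmidt2013, §2 (definition of the flat norm) and Theorem 2.6 (p0007–p0008)] -/
def testFn (b v : Plane) (p : Plane) : ℝ :=
  1 / 4 * min (⟪p - b, v⟫ ^ 2) 4

/-- `φ_{b,v}` is `1`-Lipschitz for a unit vector `v`. [folklore] -/
private theorem testFn_lipschitz (b : Plane) {v : Plane} (hv : ‖v‖ = 1) : LipschitzWith 1 (testFn b v) := by
  refine LipschitzWith.of_dist_le_mul fun p p' => ?_
  rw [NNReal.coe_one, one_mul, Real.dist_eq, testFn, testFn, ← mul_sub, abs_mul,
    abs_of_pos (by norm_num : (0 : ℝ) < 1 / 4)]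
  have h1 := abs_min_sq_four_sub_le ⟪p - b, v⟫ ⟪p' - b, v⟫
  have h2 : |⟪p - b, v⟫ - ⟪p' - b, v⟫| ≤ dist p p' := by
    rw [← inner_sub_left, show p - b - (p' - b) = p - p' by abel, dist_eq_norm]
    calc |⟪p - p', v⟫| ≤ ‖p - p'‖ * ‖v‖ := abs_real_inner_le_norm _ _
      _ = ‖p - p'‖ := by rw [hv, mul_one]
  linarith

/-- `0 ≤ φ_{b,v}`. [folklore] -/
private theorem testFn_nonneg (b v p : Plane) : 0 ≤ testFn b v p :=
  mul_nonneg (by norm_num) (le_min (sq_nonneg _) (by norm_num))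

/-- `φ_{b,v} ≤ 1`. [folklore] -/
private theorem testFn_le_one (b v p : Plane) : testFn b v p ≤ 1 := by
  unfold testFn
  have := min_le_right (⟪p - b, v⟫ ^ 2) 4
  linarith

/-- `|φ_{b,v}| ≤ 1`. [folklore] -/
private theorem abs_testFn_le_one (b v p : Plane) : |testFn b v p| ≤ 1 := by
  rw [abs_of_nonneg (testFn_nonneg b v p)]
  exact testFn_le_one b v p

/-- `φ_{b,v}(p) ≤ ¼⟨p − b, v⟩²`. [folklore] -/
private theorem testFn_le_sq (b v p : Plane) : testFn b v p ≤ 1 / 4 * ⟪p - b, v⟫ ^ 2 :=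
  mul_le_mul_of_nonneg_left (min_le_left _ _) (by norm_num)

/-- `φ_{b,v}(p) = ¼⟨p − b, v⟩²` inside the slab `|⟨p − b, v⟩| ≤ 2`. [folklore] -/
private theorem testFn_eq_sq {b v p : Plane} (h : |⟪p - b, v⟫| ≤ 2) : testFn b v p = 1 / 4 * ⟪p - b, v⟫ ^ 2 := by
  unfold testFn
  rw [min_eq_left]
  nlinarith [abs_nonneg ⟪p - b, v⟫, sq_abs ⟪p - b, v⟫]

/-- `φ_{b,v}(p) ≥ 1/16` outside the slab `|⟨p − b, v⟩| < ½`. [folklore] -/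
private theorem testFn_ge {b v p : Plane} (h : 1 / 2 ≤ |⟪p - b, v⟫|) : 1 / 16 ≤ testFn b v p := by
  unfold testFn
  have : 1 / 4 ≤ min (⟪p - b, v⟫ ^ 2) 4 :=
    le_min (by nlinarith [abs_nonneg ⟪p - b, v⟫, sq_abs ⟪p - b, v⟫]) (by norm_num)
  linarith

open AuYeungFrieseckeSchmidt2012 (empiricalIntegral)

variable {N : ℕ}

/-- **Admissible test functions bound the flat norm from below**:
`∫ φ dμ_N' − ∫ φ dμ̃ ≤ ‖μ_N' − μ̃‖` for `φ` `1`-Lipschitz with `|φ| ≤ 1`.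
[cite: Schmidt2013, §2 (definition of the flat norm) (p0007)] -/
theorem sub_le_flatNorm (x y : Fin N → Plane) {φ : Plane → ℝ} (hφ : LipschitzWith 1 φ)
    (hφ1 : ∀ p, |φ p| ≤ 1) :
    empiricalIntegral x φ - empiricalIntegral y φ ≤
      flatNorm fun ψ => empiricalIntegral x ψ - empiricalIntegral y ψ := by
  unfold flatNorm
  refine le_csSup ?_ ⟨φ, hφ, hφ1, rfl⟩
  refine ⟨2, ?_⟩
  rintro t ⟨ψ, -, hψ1, rfl⟩
  have h1 := abs_empiricalIntegral_le_one x hψ1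
  have h2 := abs_empiricalIntegral_le_one y hψ1
  rw [abs_le] at h1 h2
  linarith

/-! ## §7 The two empirical integrals of the test function -/

/-- The unit vector `e₂ = (0, 1)`, normal to the long axis of `D(a,L)`. [folklore] -/
def e₂ : Plane := EuclideanSpace.single 1 1

/-- `‖e₂‖ = 1`. [folklore] -/
private theorem norm_e₂ : ‖e₂‖ = 1 := by
  simp [e₂]

/-- `⟨p, e₂⟩ = p₁`. [folklore] -/
private theorem inner_e₂ (p : Plane) : ⟪p, e₂⟫ = p 1 := by
  simp [e₂, EuclideanSpace.inner_single_right]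

/-- The empirical integral of a labelled configuration is a sum over its label set.
[cite: Schmidt2013, (1.3) (p0003)] -/
theorem empiricalIntegral_labelConfig (S : Finset (ℤ × ℤ)) (h : S.card = N) (F : Plane → Plane)
    (φ : Plane → ℝ) :
    empiricalIntegral (fun i => F (labelConfig S h i)) φ =
      (N : ℝ)⁻¹ * ∑ q ∈ S, φ ((Real.sqrt N)⁻¹ • F (triPoint q)) := by
  unfold empiricalIntegral
  rw [sum_labelConfig S h (fun p => φ ((Real.sqrt N)⁻¹ • F p))]

/-- **Upper bound for the moved elongated ground state**: with `b = a/√N`, `v = R e₂`,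
`∫ φ_{b,v} dμ̃_N(R · + a) ≤ (3/16) N⁻² Σ_{(m,n) ∈ D} n²` (the test function sees only the thin
direction of `D(a,L)`, in which `⟨R(triPoint q) + a − a, R e₂⟩ = (√3/2) n`).
[cite: Schmidt2013, Theorem 2.6 (p0007–p0008)] -/
theorem empiricalIntegral_moved_le (D : Finset (ℤ × ℤ)) (h : D.card = N) (hN : 0 < N)
    (R : Plane ≃ₗᵢ[ℝ] Plane) (t : Plane) :
    empiricalIntegral (fun i => R (labelConfig D h i) + t)
        (testFn ((Real.sqrt N)⁻¹ • t) (R e₂)) ≤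
      3 / 16 * ((N : ℝ) ^ 2)⁻¹ * ∑ q ∈ D, ((q.2 : ℝ)) ^ 2 := by
  have hNr : (0 : ℝ) < N := by exact_mod_cast hN
  have hc2 : ((Real.sqrt N)⁻¹) ^ 2 = (N : ℝ)⁻¹ := by
    rw [inv_pow, Real.sq_sqrt hNr.le]
  rw [empiricalIntegral_labelConfig D h (fun p => R p + t)]
  have hpt : ∀ q ∈ D, testFn ((Real.sqrt N)⁻¹ • t) (R e₂) ((Real.sqrt N)⁻¹ • (R (triPoint q) + t)) ≤
      1 / 4 * ((N : ℝ)⁻¹ * (3 / 4 * ((q.2 : ℝ)) ^ 2)) := by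
    intro q _
    refine (testFn_le_sq _ _ _).trans (le_of_eq ?_)
    have e : (Real.sqrt N)⁻¹ • (R (triPoint q) + t) - (Real.sqrt N)⁻¹ • t =
        (Real.sqrt N)⁻¹ • R (triPoint q) := by
      rw [smul_add, add_sub_cancel_right]
    rw [e, real_inner_smul_left, LinearIsometryEquiv.inner_map_map, inner_e₂, Theil2006.triPoint_apply_one]
    have h3 : Real.sqrt 3 ^ 2 = 3 := Real.sq_sqrt (by norm_num)
    rw [← hc2]
    linear_combination (((Real.sqrt N)⁻¹) ^ 2 * ((q.2 : ℝ)) ^ 2 / 16) * h3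
  calc (N : ℝ)⁻¹ * ∑ q ∈ D, testFn ((Real.sqrt N)⁻¹ • t) (R e₂) ((Real.sqrt N)⁻¹ • (R (triPoint q) + t))
      ≤ (N : ℝ)⁻¹ * ∑ q ∈ D, 1 / 4 * ((N : ℝ)⁻¹ * (3 / 4 * ((q.2 : ℝ)) ^ 2)) :=
        mul_le_mul_of_nonneg_left (sum_le_sum hpt) (inv_nonneg.2 hNr.le)
    _ = 3 / 16 * ((N : ℝ) ^ 2)⁻¹ * ∑ q ∈ D, ((q.2 : ℝ)) ^ 2 := by
        rw [← mul_sum, ← mul_sum, ← mul_sum]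
        field_simp
        ring


/-- The empirical integral of `labelConfig S` itself. [cite: Schmidt2013, (1.3) (p0003)] -/
theorem empiricalIntegral_labelConfig_self (S : Finset (ℤ × ℤ)) (h : S.card = N) (φ : Plane → ℝ) :
    empiricalIntegral (labelConfig S h) φ = (N : ℝ)⁻¹ * ∑ q ∈ S, φ ((Real.sqrt N)⁻¹ • triPoint q) :=
  empiricalIntegral_labelConfig S h id φ

/-- **Lower bound for the near-regular ground state, Case A** (the hexagon `H_{r−1} ⊆ S_N'` lies in the
slab `|⟨· − b, v⟩| ≤ 2`): `∫ φ_{b,v} dμ_N' ≥ (3/16) N⁻² Σ_{(m,n) ∈ H_{r−1}} n²`, by the isotropy of the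
hexagon. [cite: Schmidt2013, Theorem 2.6 (p0007–p0008)] -/
theorem empiricalIntegral_config_ge_of_slab {r a' : ℕ} (hr : 1 ≤ r) (hS : (config r a').card = N)
    (hN : 0 < N) {v : Plane} (hv : ‖v‖ = 1) (b : Plane)
    (hA : ∀ q ∈ hexagon (r - 1), |⟪(Real.sqrt N)⁻¹ • triPoint q - b, v⟫| ≤ 2) :
    3 / 16 * ((N : ℝ) ^ 2)⁻¹ * ∑ q ∈ hexagon (r - 1), ((q.2 : ℝ)) ^ 2 ≤
      empiricalIntegral (labelConfig (config r a') hS) (testFn b v) := by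
  have hNr : (0 : ℝ) < N := by exact_mod_cast hN
  have hc2 : ((Real.sqrt N)⁻¹) ^ 2 = (N : ℝ)⁻¹ := by rw [inv_pow, Real.sq_sqrt hNr.le]
  rw [empiricalIntegral_labelConfig_self]
  have h1 : ∑ q ∈ hexagon (r - 1), testFn b v ((Real.sqrt N)⁻¹ • triPoint q) ≤
      ∑ q ∈ config r a', testFn b v ((Real.sqrt N)⁻¹ • triPoint q) :=
    sum_le_sum_of_subset_of_nonneg (hexagon_subset_config hr a') fun q _ _ => testFn_nonneg b v _
  have h2 : ∑ q ∈ hexagon (r - 1), testFn b v ((Real.sqrt N)⁻¹ • triPoint q) =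
      1 / 4 * ∑ q ∈ hexagon (r - 1), ⟪(Real.sqrt N)⁻¹ • triPoint q - b, v⟫ ^ 2 := by
    rw [mul_sum]
    exact sum_congr rfl fun q hq => testFn_eq_sq (hA q hq)
  have h3 := sum_hexagon_inner_sub_sq_ge (r - 1) hv b (Real.sqrt N)⁻¹
  rw [hc2] at h3
  calc 3 / 16 * ((N : ℝ) ^ 2)⁻¹ * ∑ q ∈ hexagon (r - 1), ((q.2 : ℝ)) ^ 2
      = (N : ℝ)⁻¹ * (1 / 4 * ((N : ℝ)⁻¹ * (3 / 4 * ∑ q ∈ hexagon (r - 1), ((q.2 : ℝ)) ^ 2))) := by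
        field_simp; ring
    _ ≤ (N : ℝ)⁻¹ * ∑ q ∈ config r a', testFn b v ((Real.sqrt N)⁻¹ • triPoint q) := by
        refine mul_le_mul_of_nonneg_left ?_ (inv_nonneg.2 hNr.le)
        rw [h2] at h1
        linarith

/-- `16 r² ≤ 9N` gives `2r/√N ≤ 3/2`: the rescaled spiral configuration (`⊆ H_r`, `|triPoint q| ≤ r`)
has diameter `≤ 3/2`. [folklore] -/
private theorem two_mul_div_sqrt_le {r : ℕ} (hN : 0 < N) (h16 : 16 * r ^ 2 ≤ 9 * N) :
    (Real.sqrt N)⁻¹ * (2 * r) ≤ 3 / 2 := by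
  have hNr : (0 : ℝ) < N := by exact_mod_cast hN
  have hs : 0 < Real.sqrt N := Real.sqrt_pos.2 hNr
  have h16r : (16 : ℝ) * (r : ℝ) ^ 2 ≤ 9 * N := by exact_mod_cast h16
  have h4 : (4 : ℝ) * r ≤ 3 * Real.sqrt N := by
    have : (4 * (r : ℝ)) ^ 2 ≤ (3 * Real.sqrt N) ^ 2 := by
      rw [mul_pow, mul_pow, Real.sq_sqrt hNr.le]; linarith
    exact (pow_le_pow_iff_left₀ (by positivity) (by positivity) two_ne_zero).1 this
  rw [inv_mul_le_iff₀ hs]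
  linarith


open DavoliPiovanoStefanelli2017 (norm_triPoint_le_of_mem_hexagon)

/-- **Lower bound for the near-regular ground state, Case B** (some point of `H_{r−1}` is outside the
slab `|⟨· − b, v⟩| ≤ 2`): the rescaled configuration has diameter `≤ 2r/√N ≤ 3/2`, so all of it is at
distance `≥ ½` from the line and `∫ φ_{b,v} dμ_N' ≥ 1/16`. [cite: Schmidt2013, Theorem 2.6 (p0007–p0008)] -/
theorem empiricalIntegral_config_ge_of_far {r a' : ℕ} (hS : (config r a').card = N)
    (hN : 0 < N) (h16 : 16 * r ^ 2 ≤ 9 * N) {v : Plane} (hv : ‖v‖ = 1) (b : Plane)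
    (hB : ∃ q₀ ∈ hexagon (r - 1), 2 < |⟪(Real.sqrt N)⁻¹ • triPoint q₀ - b, v⟫|) :
    1 / 16 ≤ empiricalIntegral (labelConfig (config r a') hS) (testFn b v) := by
  obtain ⟨q₀, hq₀, hfar⟩ := hB
  have hNr : (0 : ℝ) < N := by exact_mod_cast hN
  have hc0 : 0 ≤ (Real.sqrt N)⁻¹ := inv_nonneg.2 (Real.sqrt_nonneg _)
  have hdiam := two_mul_div_sqrt_le hN h16
  have hq₀n : ‖triPoint q₀‖ ≤ r :=
    (norm_triPoint_le_of_mem_hexagon hq₀).trans (by exact_mod_cast Nat.sub_le r 1)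
  have hpt : ∀ q ∈ config r a', 1 / 16 ≤ testFn b v ((Real.sqrt N)⁻¹ • triPoint q) := by
    intro q hq
    apply testFn_ge
    have hqn : ‖triPoint q‖ ≤ r := norm_triPoint_le_of_mem_hexagon (config_subset_hexagon r a' hq)
    have hdiff : |⟪(Real.sqrt N)⁻¹ • triPoint q - b, v⟫ - ⟪(Real.sqrt N)⁻¹ • triPoint q₀ - b, v⟫| ≤
        3 / 2 := by
      rw [← inner_sub_left, show (Real.sqrt N)⁻¹ • triPoint q - b - ((Real.sqrt N)⁻¹ • triPoint q₀ - b)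
        = (Real.sqrt N)⁻¹ • (triPoint q - triPoint q₀) by rw [smul_sub]; abel]
      calc |⟪(Real.sqrt N)⁻¹ • (triPoint q - triPoint q₀), v⟫|
          ≤ ‖(Real.sqrt N)⁻¹ • (triPoint q - triPoint q₀)‖ * ‖v‖ := abs_real_inner_le_norm _ _
        _ = (Real.sqrt N)⁻¹ * ‖triPoint q - triPoint q₀‖ := by
            rw [hv, mul_one, norm_smul, Real.norm_of_nonneg hc0]
        _ ≤ (Real.sqrt N)⁻¹ * (‖triPoint q‖ + ‖triPoint q₀‖) :=
            mul_le_mul_of_nonneg_left (norm_sub_le _ _) hc0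
        _ ≤ (Real.sqrt N)⁻¹ * (2 * r) := mul_le_mul_of_nonneg_left (by linarith) hc0
        _ ≤ 3 / 2 := hdiam
    have htri := abs_sub_abs_le_abs_sub ⟪(Real.sqrt N)⁻¹ • triPoint q₀ - b, v⟫
      ⟪(Real.sqrt N)⁻¹ • triPoint q - b, v⟫
    rw [abs_sub_comm] at htri
    linarith
  rw [empiricalIntegral_labelConfig_self]
  calc (1 : ℝ) / 16 = (N : ℝ)⁻¹ * ∑ q ∈ config r a', (1 / 16 : ℝ) := by
        rw [sum_const, nsmul_eq_mul, hS]; field_simp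
    _ ≤ (N : ℝ)⁻¹ * ∑ q ∈ config r a', testFn b v ((Real.sqrt N)⁻¹ • triPoint q) :=
        mul_le_mul_of_nonneg_left (sum_le_sum hpt) (inv_nonneg.2 hNr.le)

/-! ## §8 Arithmetic of the two second moments -/

/-- **The second-moment gap.** With `Φ_H(k) = k(k+1)(5k²+5k+2) = 6Σ_{H_k} n²` and
`Φ_D(a,L) = a(a+1)(5a²+5a+2+2L(2a+1)) = 6Σ_{D(a,L)} n²`: if `N = #D(a,L)` lies in the `k`-th hexagonal
shell (`3k²+3k+1 ≤ N ≤ 3(k+1)(k+2)`), `L ≥ 20` and `L² ≤ a`, then `Φ_H(k) − Φ_D(a,L) ≥ a³L`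
(`k ≈ a + L/3`: the regular hexagon of the same area is wider than `D(a,L)` across its long axis).
[cite: Schmidt2013, Theorem 2.6 (p0007–p0008)] -/
theorem cube_mul_le_phi_sub_phi {a L k N : ℕ} (hL : 20 ≤ L) (hLa : L * L ≤ a)
    (hN1 : 3 * k ^ 2 + 3 * k + 1 ≤ N) (hN2 : N ≤ 3 * (k + 1) * (k + 2))
    (hN3 : N = 3 * a ^ 2 + 3 * a + 1 + L * (2 * a + 1)) :
    (a : ℝ) ^ 3 * L ≤ (k : ℝ) * (k + 1) * (5 * (k : ℝ) ^ 2 + 5 * k + 2) -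
      (a : ℝ) * (a + 1) * (5 * (a : ℝ) ^ 2 + 5 * a + 2 + 2 * L * (2 * a + 1)) := by
  have hLr : (20 : ℝ) ≤ L := by exact_mod_cast hL
  have hLar : (L : ℝ) * L ≤ a := by exact_mod_cast hLa
  have hN1r : 3 * (k : ℝ) ^ 2 + 3 * k + 1 ≤ N := by exact_mod_cast hN1
  have hN2r : (N : ℝ) ≤ 3 * (k + 1) * (k + 2) := by exact_mod_cast hN2
  have hN3r : (N : ℝ) = 3 * (a : ℝ) ^ 2 + 3 * a + 1 + L * (2 * a + 1) := by exact_mod_cast hN3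
  have hk0 : (0 : ℝ) ≤ k := Nat.cast_nonneg k
  have ha0 : (0 : ℝ) ≤ a := Nat.cast_nonneg a
  -- `k ≤ a + L`
  have hka : (k : ℝ) ≤ a + L := by
    by_contra h
    push Not at h
    nlinarith
  -- `3(u − w) ≥ 2aL − 6a − 5L − 5` for `u = k(k+1)`, `w = a(a+1)`
  have huw : 2 * (a : ℝ) * L - 6 * a - 5 * L - 5 ≤ 3 * ((k : ℝ) * (k + 1) - (a : ℝ) * (a + 1)) := by
    nlinarith
  have ht : (0 : ℝ) ≤ 2 * (a : ℝ) * L - 6 * a - 5 * L - 5 := by nlinarith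
  have hd : (0 : ℝ) ≤ (k : ℝ) * (k + 1) - (a : ℝ) * (a + 1) := by linarith
  have hw : (0 : ℝ) ≤ (a : ℝ) * (a + 1) := by positivity
  -- F1: `(u−w)(5u+5w+2) ≥ (u−w)·10w`
  have F1 : ((k : ℝ) * (k + 1) - (a : ℝ) * (a + 1)) * (10 * ((a : ℝ) * (a + 1))) ≤
      ((k : ℝ) * (k + 1) - (a : ℝ) * (a + 1)) *
        (5 * ((k : ℝ) * (k + 1)) + 5 * ((a : ℝ) * (a + 1)) + 2) :=
    mul_le_mul_of_nonneg_left (by linarith) hd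
  -- F2: `t·10w ≤ 3(u−w)·10w`
  have F2 : (2 * (a : ℝ) * L - 6 * a - 5 * L - 5) * (10 * ((a : ℝ) * (a + 1))) ≤
      3 * ((k : ℝ) * (k + 1) - (a : ℝ) * (a + 1)) * (10 * ((a : ℝ) * (a + 1))) :=
    mul_le_mul_of_nonneg_right huw (by positivity)
  -- F3: `a³L ≤ a w L`
  have F3 : (a : ℝ) ^ 3 * L ≤ a * ((a : ℝ) * (a + 1)) * L := by nlinarith
  -- F4: `w (5aL − 60a − 56L − 50) ≥ 0`
  have h4 : (0 : ℝ) ≤ 5 * (a : ℝ) * L - 60 * a - 56 * L - 50 := by nlinarith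
  have F4 : (0 : ℝ) ≤ ((a : ℝ) * (a + 1)) * (5 * (a : ℝ) * L - 60 * a - 56 * L - 50) :=
    mul_nonneg hw h4
  nlinarith [F1, F2, F3, F4]

/-- `Φ_H(k) ≤ (7/9) N²` when `3k²+3k+1 ≤ N`. [folklore] -/
private theorem phi_le_sq {k N : ℕ} (hN1 : 3 * k ^ 2 + 3 * k + 1 ≤ N) :
    (k : ℝ) * (k + 1) * (5 * (k : ℝ) ^ 2 + 5 * k + 2) ≤ 7 / 9 * (N : ℝ) ^ 2 := by
  have hN1r : 3 * (k : ℝ) ^ 2 + 3 * k + 1 ≤ N := by exact_mod_cast hN1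
  have hk0 : (0 : ℝ) ≤ k := Nat.cast_nonneg k
  have hu : (0 : ℝ) ≤ 3 * (k : ℝ) ^ 2 + 3 * k + 1 := by positivity
  have hsq : (3 * (k : ℝ) ^ 2 + 3 * k + 1) ^ 2 ≤ (N : ℝ) ^ 2 := pow_le_pow_left₀ hu hN1r 2
  nlinarith

/-- **From `a³L` to `N^{−1/4}`**: `N ≤ 6a²` and `√a ≤ 2L` give `N^{7/4} ≤ 36 a³√a ≤ 72 a³L`, whence
`N^{−1/4}/2400 ≤ a³L/(32N²)`. [folklore] -/
private theorem rpow_neg_quarter_le {a L N : ℕ} (hN : 0 < N) (hN6 : N ≤ 6 * a ^ 2) (haL : a ≤ 4 * L ^ 2) :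
    1 / 2400 * (N : ℝ) ^ (-(1 / 4 : ℝ)) ≤ ((N : ℝ) ^ 2)⁻¹ * ((a : ℝ) ^ 3 * L) / 32 := by
  have hNr : (0 : ℝ) < N := by exact_mod_cast hN
  have ha0 : (0 : ℝ) ≤ a := Nat.cast_nonneg a
  have hL0 : (0 : ℝ) ≤ L := Nat.cast_nonneg L
  have hN6r : (N : ℝ) ≤ 6 * (a : ℝ) ^ 2 := by exact_mod_cast hN6
  have haLr : (a : ℝ) ≤ 4 * (L : ℝ) ^ 2 := by exact_mod_cast haL
  -- `√a ≤ 2L`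
  have hsa : Real.sqrt a ≤ 2 * L := by
    rw [show (4 : ℝ) * (L : ℝ) ^ 2 = (2 * L) ^ 2 by ring] at haLr
    calc Real.sqrt a ≤ Real.sqrt ((2 * L) ^ 2) := Real.sqrt_le_sqrt haLr
      _ = 2 * L := Real.sqrt_sq (by positivity)
  -- `N^{7/4} ≤ 72 a³ L`
  have h74 : (N : ℝ) ^ (7 / 4 : ℝ) ≤ 72 * ((a : ℝ) ^ 3 * L) := by
    have s1 : (N : ℝ) ^ (7 / 4 : ℝ) ≤ (6 * (a : ℝ) ^ 2) ^ (7 / 4 : ℝ) :=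
      Real.rpow_le_rpow hNr.le hN6r (by norm_num)
    have s2 : (6 * (a : ℝ) ^ 2) ^ (7 / 4 : ℝ) = (6 : ℝ) ^ (7 / 4 : ℝ) * ((a : ℝ) ^ 2) ^ (7 / 4 : ℝ) :=
      Real.mul_rpow (by norm_num) (by positivity)
    have s3 : (6 : ℝ) ^ (7 / 4 : ℝ) ≤ 36 := by
      calc (6 : ℝ) ^ (7 / 4 : ℝ) ≤ (6 : ℝ) ^ (2 : ℝ) :=
            Real.rpow_le_rpow_of_exponent_le (by norm_num) (by norm_num)
        _ = 36 := by rw [show (2 : ℝ) = ((2 : ℕ) : ℝ) by norm_num, Real.rpow_natCast]; norm_num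
    have s4 : ((a : ℝ) ^ 2) ^ (7 / 4 : ℝ) = (a : ℝ) ^ 3 * Real.sqrt a := by
      rw [show ((a : ℝ) ^ 2) = (a : ℝ) ^ (2 : ℝ) by
            rw [show (2 : ℝ) = ((2 : ℕ) : ℝ) by norm_num, Real.rpow_natCast],
        ← Real.rpow_mul ha0, show (2 : ℝ) * (7 / 4) = (3 : ℕ) + 1 / 2 by norm_num]
      rw [Real.rpow_add' ha0 (by norm_num), Real.rpow_natCast, Real.sqrt_eq_rpow]
    have s5 : (0 : ℝ) ≤ ((a : ℝ) ^ 2) ^ (7 / 4 : ℝ) := by positivity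
    calc (N : ℝ) ^ (7 / 4 : ℝ) ≤ (6 : ℝ) ^ (7 / 4 : ℝ) * ((a : ℝ) ^ 2) ^ (7 / 4 : ℝ) := by rw [← s2]; exact s1
      _ ≤ 36 * ((a : ℝ) ^ 2) ^ (7 / 4 : ℝ) := mul_le_mul_of_nonneg_right s3 s5
      _ = 36 * ((a : ℝ) ^ 3 * Real.sqrt a) := by rw [s4]
      _ ≤ 36 * ((a : ℝ) ^ 3 * (2 * L)) := by
          have : (0 : ℝ) ≤ (a : ℝ) ^ 3 := by positivity
          nlinarith [mul_le_mul_of_nonneg_left hsa this]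
      _ = 72 * ((a : ℝ) ^ 3 * L) := by ring
  -- `N^{−1/4} = N^{7/4} / N²`
  have hsplit : (N : ℝ) ^ (-(1 / 4 : ℝ)) = (N : ℝ) ^ (7 / 4 : ℝ) * ((N : ℝ) ^ 2)⁻¹ := by
    rw [show (-(1 / 4 : ℝ)) = 7 / 4 - 2 by norm_num, Real.rpow_sub hNr,
      show (2 : ℝ) = ((2 : ℕ) : ℝ) by norm_num, Real.rpow_natCast, div_eq_mul_inv]
  rw [hsplit]
  have hW : (0 : ℝ) ≤ ((N : ℝ) ^ 2)⁻¹ := by positivity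
  have hprod := mul_le_mul_of_nonneg_right h74 hW
  calc 1 / 2400 * ((N : ℝ) ^ (7 / 4 : ℝ) * ((N : ℝ) ^ 2)⁻¹)
      ≤ 1 / 2400 * (72 * ((a : ℝ) ^ 3 * L) * ((N : ℝ) ^ 2)⁻¹) :=
        mul_le_mul_of_nonneg_left hprod (by norm_num)
    _ ≤ ((N : ℝ) ^ 2)⁻¹ * ((a : ℝ) ^ 3 * L) / 32 := by
        have : (0 : ℝ) ≤ ((a : ℝ) ^ 3 * L) * ((N : ℝ) ^ 2)⁻¹ := by positivity
        nlinarith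

/-! ## §9 Assembly: Theorem 2.6 -/

open Literature.Geometry.DiscreteGeometry (IsMaximalDiscConfig)

/-- Numerology of the parameters `a ≥ 400`, `L = ⌊√a⌋`. [folklore] -/
private theorem params_bounds {a L : ℕ} (ha : 400 ≤ a) (hLa : L * L ≤ a) (haL : a < (L + 1) * (L + 1)) :
    20 ≤ L ∧ 3 * a ^ 2 + 3 * a + 1 + L * (2 * a + 1) ≤ 6 * a ^ 2 ∧ a ≤ 4 * L ^ 2 ∧
      480000 ≤ 3 * a ^ 2 + 3 * a + 1 + L * (2 * a + 1) := by
  have hL20 : 20 ≤ L := by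
    by_contra h
    push Not at h
    have : (L + 1) * (L + 1) ≤ 20 * 20 := Nat.mul_le_mul (by omega) (by omega)
    omega
  have hL2a : L ≤ a := le_trans (Nat.le_mul_self L) hLa
  have haa : 400 * a ≤ a * a := Nat.mul_le_mul_right a ha
  have hLa2 : L * (2 * a + 1) ≤ a * (2 * a + 1) := Nat.mul_le_mul_right _ hL2a
  refine ⟨hL20, ?_, ?_, ?_⟩
  · rw [sq]; nlinarith [haa, hLa2]
  · rw [sq]; nlinarith [haL, hL20]
  · rw [sq]; nlinarith [haa, ha]

/-- Numerology of the hexagonal shell: `N = 3r² − 3r + 1 + a'`, `a' < 6r`, `r = k + 1`.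
[cite: Harborth1974, (6)] -/
theorem shell_bounds {N k a' : ℕ} (ha' : a' < 6 * (k + 1))
    (hNr : (N : ℤ) = 3 * ((k + 1 : ℕ) : ℤ) ^ 2 - 3 * ((k + 1 : ℕ) : ℤ) + 1 + a') :
    3 * k ^ 2 + 3 * k + 1 ≤ N ∧ N ≤ 3 * (k + 1) * (k + 2) := by
  have hNk : (N : ℤ) = 3 * k ^ 2 + 3 * k + 1 + a' := by rw [hNr]; push_cast; ring
  constructor
  · zify; rw [hNk]; linarith
  · zify at ha' ⊢; rw [hNk]; nlinarith

/-- `16 (k+1)² ≤ 9N` for a large `N` in the `k`-th shell (`k ≥ 2`). [folklore] -/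
private theorem sixteen_mul_sq_le {N k : ℕ} (hN1 : 3 * k ^ 2 + 3 * k + 1 ≤ N) (hN2 : N ≤ 3 * (k + 1) * (k + 2))
    (hbig : 480000 ≤ N) : 16 * (k + 1) ^ 2 ≤ 9 * N := by
  have hk : 2 ≤ k := by
    by_contra h
    push Not at h
    have : 3 * (k + 1) * (k + 2) ≤ 3 * 2 * 3 :=
      Nat.mul_le_mul (Nat.mul_le_mul_left 3 (by omega)) (by omega)
    omega
  nlinarith [hN1, hk]

/-- **The main estimate.** For the swept hexagon `D(a,L)` (`a ≥ 400`, `L = ⌊√a⌋`) and the spiral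
ground state `S'` with the same number `N` of atoms: for every `R ∈ O(2)` and `a ∈ ℝ²`,
`∫ φ dμ_N' − ∫ φ dμ̃_N(R · + a) ≥ N^{−1/4}/2400` for the test function `φ = φ_{a/√N, R e₂}`.
[cite: Schmidt2013, Theorem 2.6 (p0007–p0008)] -/
theorem main_estimate {a L r a' : ℕ} (ha : 400 ≤ a) (hLa : L * L ≤ a) (haL : a < (L + 1) * (L + 1))
    (hN : (sweptHexagon a L).card = N) (hr : 1 ≤ r) (ha' : a' < 6 * r)
    (hNr : (N : ℤ) = 3 * r ^ 2 - 3 * r + 1 + a') (hS : (config r a').card = N)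
    (R : Plane ≃ₗᵢ[ℝ] Plane) (t : Plane) :
    1 / 2400 * (N : ℝ) ^ (-(1 / 4 : ℝ)) ≤
      empiricalIntegral (labelConfig (config r a') hS) (testFn ((Real.sqrt N)⁻¹ • t) (R e₂)) -
        empiricalIntegral (fun i => R (labelConfig (sweptHexagon a L) hN i) + t)
          (testFn ((Real.sqrt N)⁻¹ • t) (R e₂)) := by
  -- numerology
  have hNval : N = 3 * a ^ 2 + 3 * a + 1 + L * (2 * a + 1) := by rw [← hN, card_sweptHexagon]
  obtain ⟨hL20, hN6, haL4, hbig⟩ := params_bounds ha hLa haL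
  rw [← hNval] at hN6 hbig
  have hNpos : 0 < N := by omega
  obtain ⟨k, rfl⟩ : ∃ k, r = k + 1 := ⟨r - 1, (Nat.sub_add_cancel hr).symm⟩
  have hk : k + 1 - 1 = k := Nat.add_sub_cancel k 1
  obtain ⟨hN1, hN2⟩ := shell_bounds ha' hNr
  have h16 : 16 * (k + 1) ^ 2 ≤ 9 * N := sixteen_mul_sq_le hN1 hN2 hbig
  have hW : (0 : ℝ) ≤ ((N : ℝ) ^ 2)⁻¹ := by positivity
  -- the two second moments
  have hΦH := six_mul_sum_hexagon_snd_sq k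
  have hΦD := six_mul_sum_sweptHexagon_snd_sq a L
  have hgap := cube_mul_le_phi_sub_phi hL20 hLa hN1 hN2 hNval
  have hpow := rpow_neg_quarter_le hNpos hN6 haL4
  have hv : ‖R e₂‖ = 1 := by rw [LinearIsometryEquiv.norm_map, norm_e₂]
  -- the moved elongated configuration
  have hY := empiricalIntegral_moved_le (sweptHexagon a L) hN hNpos R t
  by_cases hA : ∀ q ∈ hexagon (k + 1 - 1),
      |⟪(Real.sqrt N)⁻¹ • triPoint q - (Real.sqrt N)⁻¹ • t, R e₂⟫| ≤ 2
  · -- Case A: the hexagon `H_k ⊆ S'` is inside the slab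
    have hX := empiricalIntegral_config_ge_of_slab (Nat.le_add_left 1 k) hS hNpos hv _ hA
    rw [hk] at hX
    have key : ((N : ℝ) ^ 2)⁻¹ * ((a : ℝ) ^ 3 * L) ≤
        ((N : ℝ) ^ 2)⁻¹ * (6 * ∑ q ∈ hexagon k, ((q.2 : ℝ)) ^ 2 -
          6 * ∑ q ∈ sweptHexagon a L, ((q.2 : ℝ)) ^ 2) :=
      mul_le_mul_of_nonneg_left (by rw [hΦH, hΦD]; exact hgap) hW
    linarith
  · -- Case B: all of `S'` is far from the line
    push Not at hA
    have hX := empiricalIntegral_config_ge_of_far hS hNpos h16 hv _ hA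
    have hle := phi_le_sq hN1
    have key : ((N : ℝ) ^ 2)⁻¹ * (6 * ∑ q ∈ sweptHexagon a L, ((q.2 : ℝ)) ^ 2) ≤
        ((N : ℝ) ^ 2)⁻¹ * (7 / 9 * (N : ℝ) ^ 2) := by
      refine mul_le_mul_of_nonneg_left ?_ hW
      rw [hΦD]
      have : (0 : ℝ) ≤ (a : ℝ) ^ 3 * L := by positivity
      linarith
    have hone : (N : ℝ) ^ (-(1 / 4 : ℝ)) ≤ 1 :=
      Real.rpow_le_one_of_one_le_of_nonpos (by exact_mod_cast hNpos) (by norm_num)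
    have hNr0 : (0 : ℝ) < N := by exact_mod_cast hNpos
    have hWN : ((N : ℝ) ^ 2)⁻¹ * (7 / 9 * (N : ℝ) ^ 2) = 7 / 9 := by
      field_simp
    linarith

/-- **Schmidt 2013, Theorem 2.6 PROVED: the rate `N^{−1/4}` of Theorem 2.4 is optimal.**  With
`c = 1/2400`: for every `N₀` there is `N ≥ N₀` (namely `N = #D(a,L)`, `a = max(400,N₀)`, `L = ⌊√a⌋`)
and two sticky-disc ground states with `N` atoms — Harborth's near-regular spiral configuration
`S_N'` and the elongated hexagon `D(a,L)` (side lengths differing by `∼ N^{1/4}` lattice units, as the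
`H̃` of the printed proof) — whose rescaled empirical measures satisfy
`‖μ_N' − μ̃_N(R · + a)‖ ≥ c N^{−1/4}` for every `R ∈ O(2)`, `a ∈ ℝ²`.  The printed proof sketch bounds
the symmetric difference `|H △ (RH̃ + a)| ≥ cN^{3/4}` and appeals to rescaling; here the flat-norm lower
bound is certified instead by the admissible test function `φ = ¼ min(⟨· − a/√N, Re₂⟩², 4)`, a clipped
second moment across the long axis of the elongated state, which separates the two states at order
`N^{−1/4}` by the exact row sums `Σ n²` of the hexagon (isotropic) and of `D(a,L)`.
[cite: Schmidt2013, Theorem 2.6 (p0007–p0008)] -/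
theorem Schmidt2013_deviationLowerBound_holds : Schmidt2013_deviationLowerBound := by
  refine ⟨1 / 2400, by norm_num, fun N₀ => ?_⟩
  obtain ⟨a, ha400, haN₀⟩ : ∃ a : ℕ, 400 ≤ a ∧ N₀ ≤ a := ⟨max 400 N₀, le_max_left _ _, le_max_right _ _⟩
  have hLa : Nat.sqrt a * Nat.sqrt a ≤ a := Nat.sqrt_le a
  have haL : a < (Nat.sqrt a + 1) * (Nat.sqrt a + 1) := Nat.lt_succ_sqrt a
  set L := Nat.sqrt a with hL
  set N := (sweptHexagon a L).card with hNdef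
  have hN : (sweptHexagon a L).card = N := rfl
  have hNval : N = 3 * a ^ 2 + 3 * a + 1 + L * (2 * a + 1) := card_sweptHexagon a L
  have hNpos : 0 < N := by rw [hNval]; positivity
  have hN₀ : N₀ ≤ N := by rw [hNval]; nlinarith
  obtain ⟨r, a', hr, ha', hNr⟩ := exists_ring_decomposition (show 1 ≤ N from hNpos)
  obtain ⟨hS, hSadj⟩ := card_config_eq_and_adjCount hr ha' hNr
  have hDadj : (adjCount (sweptHexagon a L) : ℤ) = 2 * harborthNumber N := by
    rw [← hN]
    exact adjCount_sweptHexagon (by omega)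
  refine ⟨N, hN₀, labelConfig (config r a') hS, labelConfig (sweptHexagon a L) hN,
    isMaximalDiscConfig_labelConfig hS hSadj, isMaximalDiscConfig_labelConfig hN hDadj, fun R t => ?_⟩
  have hv : ‖R e₂‖ = 1 := by rw [LinearIsometryEquiv.norm_map, norm_e₂]
  exact (main_estimate ha400 hLa haL hN hr ha' hNr hS R t).trans
    (sub_le_flatNorm _ _ (testFn_lipschitz _ hv) (abs_testFn_le_one _ _))

end Literature.MathematicalPhysics.StatisticalMechanics.Schmidt2013

end
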